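import Summits.QuantumFields.YangMills.Theorems.LuscherReductionOneSiteLevelsGnKinetic
import Summits.QuantumFields.YangMills.Theorems.LuscherReductionOneSiteLevelsGnHaar
import Literature.Analysis.OperatorTheory.YangMillsMatrixModelQuasimodes

/-!
# The transfer kernel in the gnomonic chart: magnetic potential, kinetic Gaussian, density
# (support module for the registered stub `stub_absLower` of crux `OneSiteLevels`, route `LuscherReduction`,
# item stmt-QuantumFields-20007; fleet seat prover ym-luscher-20007-p2)

Explicit formulas, on Lüscher's zero-mode space `ZM = ℝ⁹` and at chart scale `μ`, for the three factors of the one-site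
transfer kernel `K_B(U,U') = exp(B Σ_e Re tr(U_eU'_e⁻¹) − (B/2)(S(U)+S(U')))` evaluated at chart points `U = gnChart μ σ y`,
`U' = gnChart μ σ' y'`:

* MAGNETIC: `S(gnChart μ σ y) = 8 · gnPot μ y` (`wilsonAction_gnChart`) with the EXPLICIT, pattern-independent
  `gnPot μ y = ¼ μ⁴ Σ_{i,j} c_i c_j |y_i × y_j|²`, `c_i = (1 + μ²|y_i|²)⁻¹` (`gnC`), and `0 ≤ gnPot μ y ≤ μ⁴ V(y)`;
* KINETIC, same pattern: `Σ_e Re tr = 6 − μ²‖y − y'‖² + Σ_i d_i` with `0 ≤ Σ_i d_i ≤ μ⁴‖y−y'‖²(‖y‖²+‖y'‖²)`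
  (`timeCoupling_gnChart_same`, `sum_gnDefect_le`), hence
  `K = e^{6B} e^{−Bμ²‖y−y'‖²} e^{BΣd} e^{−4B(gnPot y + gnPot y')}` (`transferKernel_gnChart_same`);
* KINETIC, different patterns, inside the window `μ²|y_i|², μ²|y'_i|² ≤ 1/16`: `K ≤ e^{9B/4}` (`transferKernel_gnChart_ne_le`);
* DENSITY: `gnDensityReal μ y = μ⁹(2π²)⁻³ Π_i c_i²` (`gnDensityReal_eq`) with `1 − 6μ²‖y‖² ≤ Π_i c_i² ≤ 1`.

## WHAT THIS IS NOT
Algebra only; NOT the stub, NOT THE CLAY GAP.  Sorry-free, no named fact.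
-/

set_option autoImplicit false

noncomputable section

open MeasureTheory Filter Topology Real
open scoped Matrix Quaternion
open Literature.MathematicalPhysics.QuantumFieldTheory
open Literature.MathematicalPhysics.QuantumLattice
open Literature.Analysis.OperatorTheory.YMMatrixModel
open Literature.MathematicalPhysics.QuantumFieldTheory.Balaban1983to89.T4CubeChartGnomonic (gnoPoint gnoWeight)

namespace Summit.QuantumFields.YangMills.Theorems.FemtoTransferGap

/-! ### §1. The chart weights `c_i = (1 + μ²|y_i|²)⁻¹` -/

/-- `c_i(y) = (1 + μ²|y_i|²)⁻¹ ∈ (0,1]`, the inverse squared norm of the gnomonic quaternion of block `i`. [folklore] -/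
def gnC (μ : ℝ) (y : ZM) (i : Fin 3) : ℝ := (1 + μ ^ 2 * csq i y)⁻¹

/-- `‖(1, μ y_i)‖² = 1 + μ² |y_i|²`. [folklore] -/
theorem norm_gnomonicQuat_block_sq (μ : ℝ) (y : ZM) (i : Fin 3) :
    ‖gnomonicQuat (fun a => μ * y (i, a))‖ ^ 2 = 1 + μ ^ 2 * csq i y := by
  rw [sq_norm_gnomonicQuat, csq_eq_sum, Finset.mul_sum]
  congr 1
  exact Finset.sum_congr rfl fun a _ => by ring

/-- `0 < c_i`. [folklore] -/
theorem gnC_pos (μ : ℝ) (y : ZM) (i : Fin 3) : 0 < gnC μ y i := by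
  unfold gnC; have := csq_nonneg i y; positivity

/-- `c_i ≤ 1`. [folklore] -/
theorem gnC_le_one (μ : ℝ) (y : ZM) (i : Fin 3) : gnC μ y i ≤ 1 := by
  unfold gnC
  have := csq_nonneg i y
  exact inv_le_one_of_one_le₀ (by nlinarith [sq_nonneg μ])

/-- `c_i ≥ 1 − μ²|y_i|²`. [folklore] -/
theorem one_sub_le_gnC (μ : ℝ) (y : ZM) (i : Fin 3) : 1 - μ ^ 2 * csq i y ≤ gnC μ y i := by
  unfold gnC
  have h := csq_nonneg i y
  rw [inv_eq_one_div, le_div_iff₀ (by positivity)]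
  nlinarith [sq_nonneg (μ ^ 2 * csq i y)]

/-- `c_i = ‖(1, μ y_i)‖⁻²`. [folklore] -/
theorem gnC_eq_inv_norm_sq (μ : ℝ) (y : ZM) (i : Fin 3) :
    gnC μ y i = (‖gnomonicQuat (fun a => μ * y (i, a))‖ ^ 2)⁻¹ := by
  rw [norm_gnomonicQuat_block_sq, gnC]

/-! ### §2. Colour vectors of a chart configuration and the magnetic potential -/

/-- The real sign of a hemisphere. [folklore] -/
def hemiSign (b : Bool) : ℝ := if b then -1 else 1

/-- `hemiSign b ^ 2 = 1`. [folklore] -/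
theorem hemiSign_sq (b : Bool) : hemiSign b ^ 2 = 1 := by unfold hemiSign; cases b <;> norm_num

/-- The vector part of a chart link: `vecPart((gnChart μ σ y)_i) = hemiSign(σ_i) · ‖(1,μy_i)‖⁻¹ · μ y_i`. [folklore] -/
theorem vecPart_gnChart (μ : ℝ) (σ : Fin 3 → Bool) (y : ZM) (i : Fin 3) (a : Fin 3) :
    vecPart (gnChart μ σ y (edgeOf i)) a = hemiSign (σ i) * ‖gnomonicQuat (fun b => μ * y (i, b))‖⁻¹ * (μ * y (i, a)) := by
  show vecPart (hemi (σ (edgeOf i).2) * gnoPoint (fun b => μ * y ((edgeOf i).2, b))) a = _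
  simp only [edgeOf]
  cases h : σ i
  · simp only [hemi, hemiSign, Bool.false_eq_true, if_false]
    rw [one_mul, vecPart_gnoPoint]; ring
  · simp only [hemi, hemiSign, if_true]
    rw [vecPart_negOne_mul, Pi.neg_apply, vecPart_gnoPoint]; ring

/-- The colour vectors of `zmCoord 1 (gnChart μ σ y)` are multiples of those of `y`:
`x_i = (hemiSign σ_i · ‖(1,μy_i)‖⁻¹ · μ) • y_i`. [folklore] -/
theorem colourVec_zmCoord_gnChart (μ : ℝ) (σ : Fin 3 → Bool) (y : ZM) (i : Fin 3) :
    colourVec (zmCoord 1 (gnChart μ σ y)) i =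
      (hemiSign (σ i) * ‖gnomonicQuat (fun b => μ * y (i, b))‖⁻¹ * μ) • colourVec y i := by
  funext a
  rw [colourVec_zmCoord]
  show vecPart (gnChart μ σ y (edgeOf i)) a / 1 = _
  rw [div_one, vecPart_gnChart, Pi.smul_apply, smul_eq_mul]
  simp only [colourVec]
  ring

/-- Transverse squares scale: `|x_i × x_j|² = μ⁴ c_i c_j |y_i × y_j|²` for `x = zmCoord 1 (gnChart μ σ y)` — independent of
the hemisphere pattern `σ`. [folklore] -/
theorem crossSq_zmCoord_gnChart (μ : ℝ) (σ : Fin 3 → Bool) (y : ZM) (i j : Fin 3) :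
    crossSq i j (zmCoord 1 (gnChart μ σ y)) = μ ^ 4 * (gnC μ y i * gnC μ y j) * crossSq i j y := by
  unfold crossSq
  rw [colourVec_zmCoord_gnChart, colourVec_zmCoord_gnChart]
  set s := hemiSign (σ i) * ‖gnomonicQuat (fun b => μ * y (i, b))‖⁻¹ * μ with hs
  set t := hemiSign (σ j) * ‖gnomonicQuat (fun b => μ * y (j, b))‖⁻¹ * μ with ht
  rw [LinearMap.map_smul₂, LinearMap.map_smul, smul_smul, smul_dotProduct, dotProduct_smul, smul_eq_mul, smul_eq_mul]
  have hs2 : s ^ 2 = μ ^ 2 * gnC μ y i := by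
    rw [hs, mul_pow, mul_pow, hemiSign_sq, one_mul, gnC_eq_inv_norm_sq, inv_pow]
    ring
  have ht2 : t ^ 2 = μ ^ 2 * gnC μ y j := by
    rw [ht, mul_pow, mul_pow, hemiSign_sq, one_mul, gnC_eq_inv_norm_sq, inv_pow]
    ring
  calc s * t * (s * t * ((colourVec y i ⨯₃ colourVec y j) ⬝ᵥ (colourVec y i ⨯₃ colourVec y j)))
      = s ^ 2 * t ^ 2 * ((colourVec y i ⨯₃ colourVec y j) ⬝ᵥ (colourVec y i ⨯₃ colourVec y j)) := by ring
    _ = μ ^ 4 * (gnC μ y i * gnC μ y j) * ((colourVec y i ⨯₃ colourVec y j) ⬝ᵥ (colourVec y i ⨯₃ colourVec y j)) := by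
        rw [hs2, ht2]; ring

/-- **The magnetic potential in the chart**: `gnPot μ y = ¼ μ⁴ Σ_{i,j} c_i c_j |y_i × y_j|²`. [cite: Luscher1983, §2] -/
def gnPot (μ : ℝ) (y : ZM) : ℝ := (1 / 4 : ℝ) * ∑ i : Fin 3, ∑ j : Fin 3, μ ^ 4 * (gnC μ y i * gnC μ y j) * crossSq i j y

/-- Lüscher's potential of the chart configuration is `gnPot`: `V(zmCoord 1 (gnChart μ σ y)) = gnPot μ y`. [cite: Luscher1983, §2] -/
theorem luscherPotential_zmCoord_gnChart (μ : ℝ) (σ : Fin 3 → Bool) (y : ZM) :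
    luscherPotential (zmCoord 1 (gnChart μ σ y)) = gnPot μ y := by
  rw [luscherPotential_eq_sum_crossSq, gnPot]
  congr 1
  exact Finset.sum_congr rfl fun i _ => Finset.sum_congr rfl fun j _ => crossSq_zmCoord_gnChart μ σ y i j

/-- **`S(gnChart μ σ y) = 8 · gnPot μ y`** (exact, all patterns). [cite: Luscher1983, §2] -/
theorem wilsonAction_gnChart (μ : ℝ) (σ : Fin 3 → Bool) (y : ZM) : wilsonAction su2Rep (gnChart μ σ y) = 8 * gnPot μ y := by
  rw [wilsonAction_one_site_eq_luscherPotential, luscherPotential_zmCoord_gnChart]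

/-- `0 ≤ gnPot`. [folklore] -/
theorem gnPot_nonneg (μ : ℝ) (y : ZM) : 0 ≤ gnPot μ y := by
  unfold gnPot
  refine mul_nonneg (by norm_num) (Finset.sum_nonneg fun i _ => Finset.sum_nonneg fun j _ => ?_)
  have := gnC_pos μ y i; have := gnC_pos μ y j; have := crossSq_nonneg i j y
  positivity

/-- **`gnPot μ y ≤ μ⁴ V(y)`** (`c_i ≤ 1`): the chart potential is below the flat quartic. [folklore] -/
theorem gnPot_le (μ : ℝ) (y : ZM) : gnPot μ y ≤ μ ^ 4 * luscherPotential y := by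
  rw [gnPot, luscherPotential_eq_sum_crossSq]
  have key : ∑ i : Fin 3, ∑ j : Fin 3, μ ^ 4 * (gnC μ y i * gnC μ y j) * crossSq i j y ≤
      ∑ i : Fin 3, ∑ j : Fin 3, μ ^ 4 * crossSq i j y := by
    refine Finset.sum_le_sum fun i _ => Finset.sum_le_sum fun j _ => ?_
    have h1 := gnC_le_one μ y i; have h2 := gnC_le_one μ y j
    have h3 := gnC_pos μ y i; have h4 := gnC_pos μ y j; have h5 := crossSq_nonneg i j y
    have : gnC μ y i * gnC μ y j ≤ 1 := by nlinarith
    calc μ ^ 4 * (gnC μ y i * gnC μ y j) * crossSq i j y ≤ μ ^ 4 * 1 * crossSq i j y := by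
          exact mul_le_mul_of_nonneg_right (mul_le_mul_of_nonneg_left this (by positivity)) h5
      _ = μ ^ 4 * crossSq i j y := by ring
  have e : ∑ i : Fin 3, ∑ j : Fin 3, μ ^ 4 * crossSq i j y = μ ^ 4 * ∑ i : Fin 3, ∑ j : Fin 3, crossSq i j y := by
    rw [Finset.mul_sum]; exact Finset.sum_congr rfl fun i _ => by rw [Finset.mul_sum]
  rw [e] at key
  nlinarith [key]

/-! ### §3. The time-like coupling of two chart configurations -/

/-- Squared coordinate length of the scaled block difference: `vsq(μ y_i − μ y'_i) = μ² |y_i − y'_i|²`. [folklore] -/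
theorem vsq_block_sub (μ : ℝ) (y y' : ZM) (i : Fin 3) :
    vsq ((fun a => μ * y (i, a)) - fun a => μ * y' (i, a)) = μ ^ 2 * csq i (y - y') := by
  rw [vsq, csq_eq_sum, Finset.mul_sum]
  refine Finset.sum_congr rfl fun a _ => ?_
  simp only [Pi.sub_apply, PiLp.sub_apply]
  ring

/-- `vsq(μ y_i) = μ²|y_i|²`. [folklore] -/
theorem vsq_block (μ : ℝ) (y : ZM) (i : Fin 3) : vsq (fun a => μ * y (i, a)) = μ ^ 2 * csq i y := by
  rw [vsq, csq_eq_sum, Finset.mul_sum]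
  exact Finset.sum_congr rfl fun a _ => by ring

/-- The time-like coupling is a sum over the three directions. [folklore] -/
theorem timeCoupling_gnChart (μ : ℝ) (σ σ' : Fin 3 → Bool) (y y' : ZM) :
    timeCoupling su2Rep (gnChart μ σ y) (gnChart μ σ' y') =
      ∑ i : Fin 3, (((hemi (σ i) * gnoPoint (fun a => μ * y (i, a)) *
        (hemi (σ' i) * gnoPoint (fun a => μ * y' (i, a)))⁻¹ : SU2) : Matrix (Fin 2) (Fin 2) ℂ).trace).re := by
  unfold timeCoupling
  rw [← edgeFin.symm.sum_comp]
  rfl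

/-- **Same pattern**: `Σ_e Re tr(U_e U'_e⁻¹) = 6 − μ²‖y − y'‖² + Σ_i d_i`, `d_i = gnDefect(μy_i, μy'_i)`. [folklore] -/
theorem timeCoupling_gnChart_same (μ : ℝ) (σ : Fin 3 → Bool) (y y' : ZM) :
    timeCoupling su2Rep (gnChart μ σ y) (gnChart μ σ y') =
      6 - μ ^ 2 * ‖y - y'‖ ^ 2 + ∑ i : Fin 3, gnDefect (fun a => μ * y (i, a)) (fun a => μ * y' (i, a)) := by
  rw [timeCoupling_gnChart]
  simp_rw [re_trace_chart_same, vsq_block_sub]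
  rw [Finset.sum_add_distrib, Finset.sum_sub_distrib, Finset.sum_const, Finset.card_univ, Fintype.card_fin,
    ← Finset.mul_sum, ← norm_sq_eq_sum_csq]
  norm_num

/-- The total defect is nonnegative. [folklore] -/
theorem sum_gnDefect_nonneg (μ : ℝ) (y y' : ZM) :
    0 ≤ ∑ i : Fin 3, gnDefect (fun a => μ * y (i, a)) (fun a => μ * y' (i, a)) :=
  Finset.sum_nonneg fun _ _ => gnDefect_nonneg _ _

/-- **The total defect is `O(μ⁴‖y−y'‖²(‖y‖²+‖y'‖²))`**. [folklore] -/
theorem sum_gnDefect_le (μ : ℝ) (y y' : ZM) :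
    ∑ i : Fin 3, gnDefect (fun a => μ * y (i, a)) (fun a => μ * y' (i, a)) ≤
      μ ^ 4 * ‖y - y'‖ ^ 2 * (‖y‖ ^ 2 + ‖y'‖ ^ 2) := by
  have hcsq : ∀ i, csq i y ≤ ‖y‖ ^ 2 := fun i => by
    rw [norm_sq_eq_sum_csq]
    exact Finset.single_le_sum (fun j _ => csq_nonneg j y) (Finset.mem_univ i)
  have hcsq' : ∀ i, csq i y' ≤ ‖y'‖ ^ 2 := fun i => by
    rw [norm_sq_eq_sum_csq]
    exact Finset.single_le_sum (fun j _ => csq_nonneg j y') (Finset.mem_univ i)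
  calc ∑ i : Fin 3, gnDefect (fun a => μ * y (i, a)) (fun a => μ * y' (i, a))
      ≤ ∑ i : Fin 3, μ ^ 2 * csq i (y - y') * (μ ^ 2 * (‖y‖ ^ 2 + ‖y'‖ ^ 2)) := by
        refine Finset.sum_le_sum fun i _ => ?_
        refine (gnDefect_le _ _).trans ?_
        rw [vsq_block_sub, vsq_block, vsq_block]
        refine mul_le_mul_of_nonneg_left ?_ (by have := csq_nonneg i (y - y'); positivity)
        nlinarith [hcsq i, hcsq' i, sq_nonneg μ]
    _ = μ ^ 4 * ‖y - y'‖ ^ 2 * (‖y‖ ^ 2 + ‖y'‖ ^ 2) := by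
        rw [← Finset.sum_mul, ← Finset.mul_sum, ← norm_sq_eq_sum_csq]; ring

/-- **The transfer kernel at two chart points of the same pattern**:
`K = exp(6B − Bμ²‖y−y'‖² + BΣd_i − 4B(gnPot y + gnPot y'))`. [folklore] -/
theorem transferKernel_gnChart_same (B μ : ℝ) (σ : Fin 3 → Bool) (y y' : ZM) :
    transferKernel su2Rep B (gnChart μ σ y) (gnChart μ σ y') =
      Real.exp (6 * B - B * μ ^ 2 * ‖y - y'‖ ^ 2 + B * ∑ i : Fin 3, gnDefect (fun a => μ * y (i, a)) (fun a => μ * y' (i, a))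
        - 4 * B * (gnPot μ y + gnPot μ y')) := by
  rw [transferKernel_eq_linkE_mul, linkE_eq_exp, timeCoupling_gnChart_same, wilsonAction_gnChart, wilsonAction_gnChart,
    ← Real.exp_add]
  congr 1; ring

/-- The kernel at two chart points of the same pattern does not depend on the pattern. [folklore] -/
theorem transferKernel_gnChart_same_eq (B μ : ℝ) (σ σ₀ : Fin 3 → Bool) (y y' : ZM) :
    transferKernel su2Rep B (gnChart μ σ y) (gnChart μ σ y') = transferKernel su2Rep B (gnChart μ σ₀ y) (gnChart μ σ₀ y') := by
  rw [transferKernel_gnChart_same, transferKernel_gnChart_same]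

/-- **Different patterns, inside the window**: if `μ²|y_i|² ≤ 1/16` and `μ²|y'_i|² ≤ 1/16` for all `i` and `σ ≠ σ'`, then
`Σ_e Re tr(U_eU'_e⁻¹) ≤ 9/4` (one link is nearly antipodal). [folklore] -/
theorem timeCoupling_gnChart_ne_le {μ : ℝ} {σ σ' : Fin 3 → Bool} (hσ : σ ≠ σ') {y y' : ZM}
    (hy : ∀ i, μ ^ 2 * csq i y ≤ 1 / 16) (hy' : ∀ i, μ ^ 2 * csq i y' ≤ 1 / 16) :
    timeCoupling su2Rep (gnChart μ σ y) (gnChart μ σ' y') ≤ 9 / 4 := by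
  obtain ⟨i₀, hi₀⟩ : ∃ i, σ i ≠ σ' i := Function.ne_iff.1 hσ
  rw [timeCoupling_gnChart, ← Finset.add_sum_erase _ _ (Finset.mem_univ i₀)]
  have h0 : (((hemi (σ i₀) * gnoPoint (fun a => μ * y (i₀, a)) *
      (hemi (σ' i₀) * gnoPoint (fun a => μ * y' (i₀, a)))⁻¹ : SU2) : Matrix (Fin 2) (Fin 2) ℂ).trace).re ≤ -2 + 1 / 4 := by
    refine (re_trace_chart_opposite_le hi₀ _ _).trans ?_
    rw [vsq_block, vsq_block]
    linarith [hy i₀, hy' i₀]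
  have hrest : ∑ i ∈ Finset.univ.erase i₀, (((hemi (σ i) * gnoPoint (fun a => μ * y (i, a)) *
      (hemi (σ' i) * gnoPoint (fun a => μ * y' (i, a)))⁻¹ : SU2) : Matrix (Fin 2) (Fin 2) ℂ).trace).re ≤ 2 * 2 := by
    calc _ ≤ ∑ _i ∈ Finset.univ.erase i₀, (2 : ℝ) := Finset.sum_le_sum fun i _ => re_trace_mul_inv_le_two _ _
      _ = 2 * 2 := by rw [Finset.sum_const, Finset.card_erase_of_mem (Finset.mem_univ i₀)]; simp
  linarith

/-- **Cross-pattern kernel bound**: under the window condition and `σ ≠ σ'`, `K_B ≤ e^{9B/4}` (`B ≥ 0`). [folklore] -/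
theorem transferKernel_gnChart_ne_le {B μ : ℝ} (hB : 0 ≤ B) {σ σ' : Fin 3 → Bool} (hσ : σ ≠ σ') {y y' : ZM}
    (hy : ∀ i, μ ^ 2 * csq i y ≤ 1 / 16) (hy' : ∀ i, μ ^ 2 * csq i y' ≤ 1 / 16) :
    transferKernel su2Rep B (gnChart μ σ y) (gnChart μ σ' y') ≤ Real.exp (9 / 4 * B) := by
  refine (transferKernel_le_linkE hB _ _).trans ?_
  rw [linkE_eq_exp]
  exact Real.exp_le_exp.2 (by nlinarith [timeCoupling_gnChart_ne_le hσ hy hy'])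

/-! ### §4. The density in terms of the chart weights -/

/-- `gnoWeight(μ y_i) = (2π²)⁻¹ c_i²`. [folklore] -/
theorem gnoWeight_block (μ : ℝ) (y : ZM) (i : Fin 3) :
    gnoWeight (fun a => μ * y (i, a)) = (2 * π ^ 2)⁻¹ * gnC μ y i ^ 2 := by
  rw [gnoWeight, gnC, csq_eq_sum, Finset.mul_sum]
  have e : ∑ a, (μ * y (i, a)) ^ 2 = ∑ a, μ ^ 2 * y (i, a) ^ 2 := Finset.sum_congr rfl fun a _ => by ring
  rw [e, inv_pow]

/-- **`gnDensityReal μ y = μ⁹ (2π²)⁻³ Π_i c_i²`**. [folklore] -/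
theorem gnDensityReal_eq (μ : ℝ) (y : ZM) :
    gnDensityReal μ y = μ ^ 9 * ((2 * π ^ 2)⁻¹) ^ 3 * ∏ i : Fin 3, gnC μ y i ^ 2 := by
  rw [gnDensityReal]
  simp_rw [gnoWeight_block]
  rw [Finset.prod_mul_distrib, Finset.prod_const, Finset.card_univ, Fintype.card_fin]
  ring

/-- `Π_i c_i² ≤ 1`. [folklore] -/
theorem prod_gnC_sq_le_one (μ : ℝ) (y : ZM) : ∏ i : Fin 3, gnC μ y i ^ 2 ≤ 1 := by
  calc ∏ i : Fin 3, gnC μ y i ^ 2 ≤ ∏ _ : Fin 3, (1:ℝ) :=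
        Finset.prod_le_prod (fun _ _ => sq_nonneg _) fun i _ => by
          have h1 := gnC_le_one μ y i; have h2 := gnC_pos μ y i; nlinarith
    _ = 1 := by simp

/-- **`Π_i c_i² ≥ 1 − 6μ²‖y‖²`** (Bernoulli). [folklore] -/
theorem one_sub_le_prod_gnC_sq (μ : ℝ) (y : ZM) : 1 - 6 * (μ ^ 2 * ‖y‖ ^ 2) ≤ ∏ i : Fin 3, gnC μ y i ^ 2 := by
  have hcsq : ∀ i, csq i y ≤ ‖y‖ ^ 2 := fun i => by
    rw [norm_sq_eq_sum_csq]; exact Finset.single_le_sum (fun j _ => csq_nonneg j y) (Finset.mem_univ i)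
  set t : ℝ := μ ^ 2 * ‖y‖ ^ 2 with ht
  have ht0 : 0 ≤ t := by positivity
  rcases lt_or_ge 1 (6 * t) with h | h
  · have := Finset.prod_nonneg (s := (Finset.univ : Finset (Fin 3))) fun i _ => sq_nonneg (gnC μ y i)
    linarith
  · have hlow : ∀ i, 1 - t ≤ gnC μ y i := fun i =>
      le_trans (by nlinarith [hcsq i, sq_nonneg μ]) (one_sub_le_gnC μ y i)
    have h1t : 0 ≤ 1 - t := by linarith
    calc 1 - 6 * t ≤ (1 - t) ^ 6 := by
          have := one_add_mul_le_pow (show (-2:ℝ) ≤ -t by linarith) 6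
          simpa [sub_eq_add_neg, mul_comm] using this
      _ = ∏ _i : Fin 3, (1 - t) ^ 2 := by simp; ring
      _ ≤ ∏ i : Fin 3, gnC μ y i ^ 2 :=
          Finset.prod_le_prod (fun i _ => sq_nonneg _) fun i _ => pow_le_pow_left₀ h1t (hlow i) 2

end Summit.QuantumFields.YangMills.Theorems.FemtoTransferGap

end
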